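import Literature.NumberTheory.EllipticCurves.Shintani32ConeGaussSums
import Literature.NumberTheory.EllipticCurves.Shintani32KohnenWeight
import HarnessLib

/-!
# Cone Gauss sums for Kohnen's weight on the full level-`32` lattice

[[cite: Shintani1975, §1 Prop. 1.6, Thm. 2]] — the finite (arithmetic) input of the level-`128`
transformation law of the theta kernels `𝒦₃₂[χ_{D*}, 1/D]` on the FULL lattice
`L♮₃₂ = {Q_k = [32k₀, k₁, k₂]}` with Kohnen's genus weight `kohnenWt D` (`Shintani32KohnenWeight`;
discriminant `Δ(k) = k₁² - 128k₀k₂`), the kernel lifting the level-`32` newform into Tunnell's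
space WITH an informative diagonal (route to Waldspurger's corollary at level `128` and
`Literature.NumberTheory.EllipticCurves.Tunnell1983_a_sq_propto_L_one`).  Twin of
`Shintani32ConeGaussSums` (sublattice `64 ∣ k₁`, reduced discriminant `n₃₂`) for the full
discriminant `Δ`; everything is PROVED:

* prime case `sum_kohnenSymF_sub_mul_ψ`:
  `∑_{ρ ∈ 𝔽_p³} Ω_p(ρ - μ) e_p(t Δ(ρ)) = Ω_p(-μ) · p · G(t; p)` — REDUCED to the tree's
  `sum_coneSymF32_sub_mul_ψ` by the substitution `ρ₁ = 64 ρ₁'` (`Δ = 128 · n₃₂`, `G(64²t) = G(t)`);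
* CRT (`coneSumK_mul_of_coprime`), the `D`-part by induction (`dPartPropK_all`), the `2`-part at
  `M = 128` with trivial weight (`coneSumK_one_128`: `128 r₀ r₂ ≡ 0`), whence the cone Gauss sum
  `(★K)` modulo `N = 128D` (`coneSumK_wDK`):
  `∑_{r ∈ (ℤ/N)³} w_D(r - u) e_N(a Δ(r)) = w_D(-u) · 128 N · G(a; N)`;
* the bridge `kohnenWt_eq_wDK`, the vanishing of the Gauss coefficient sums
  `∑_r w_D(r) ψ_N(aΔ(r) + ℓ(r,v))` unless `128 ∣ v₀`, `2 ∣ v₁`, `128 ∣ v₂`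
  (`sum_wDK_mul_stdAddChar_eq_zero_of_*`, shifts `r₀ ↦ r₀ + D`, `r₂ ↦ r₂ + D`, `r₁ ↦ r₁ + 64D`),
  and the completed square on that support (`sum_wDK_mul_stdAddChar_bZK`).

No named facts.  Definitions: `ΔF`, `kohnenSymF`, `e64`, `nZK`, `coneSumK`, `kohnenSymZ`, `wDK`,
`DPartPropK`, `bZK`.
-/

noncomputable section

open Complex Finset

namespace Literature.NumberTheory.EllipticCurves.Shintani

open Literature.NumberTheory.EllipticCurves.ModularForms (quadGaussSum quadGaussSum_def
  quadGaussSum_mul_of_coprime quadGaussSum_unit_sq_mul quadGaussSum_eq_one_of_eq_one)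

/-! ### The prime case, by reduction to `Shintani32ConeGaussSums` -/

section FiniteField

variable {p : ℕ} [hp : Fact p.Prime]

/-- `Δ(ρ) = ρ₁² - 128 ρ₀ ρ₂` over `𝔽_p`. [folklore] -/
def ΔF (ρ : Fin 3 → ZMod p) : ZMod p := ρ 1 ^ 2 - 128 * ρ 0 * ρ 2

/-- **Kohnen's local symbol over `𝔽_p`**: `0` off the cone `Δ = 0`; on it `χ(ρ₂)` if `ρ₀ = 0`,
else `χ(2ρ₀)`. [folklore] -/
def kohnenSymF (ρ : Fin 3 → ZMod p) : ℂ :=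
  if ΔF ρ = 0 then (if ρ 0 = 0 then χc p (ρ 2) else χc p (2 * ρ 0)) else 0

/-- `kohnenSymF_of_ne` (auxiliary). [folklore] -/
theorem kohnenSymF_of_ne {ρ : Fin 3 → ZMod p} (h : ΔF ρ ≠ 0) : kohnenSymF ρ = 0 := by
  simp [kohnenSymF, h]

/-- The substitution `ρ₁ ↦ ρ₁/64` (identity on `ρ₀, ρ₂`). [folklore] -/
def e64 (hp2 : p ≠ 2) : (Fin 3 → ZMod p) ≃ (Fin 3 → ZMod p) where
  toFun ρ := fun i ↦ if i = 1 then (64 : ZMod p)⁻¹ * ρ 1 else ρ i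
  invFun ρ := fun i ↦ if i = 1 then 64 * ρ 1 else ρ i
  left_inv ρ := by
    funext i
    by_cases hi : i = 1
    · subst hi; simp only [if_true]
      rw [← mul_assoc, mul_inv_cancel₀ (c64_ne_zero_zmod hp2), one_mul]
    · simp [hi]
  right_inv ρ := by
    funext i
    by_cases hi : i = 1
    · subst hi; simp only [if_true]
      rw [← mul_assoc, inv_mul_cancel₀ (c64_ne_zero_zmod hp2), one_mul]
    · simp [hi]

/-- `e64_apply_zero` (auxiliary). [folklore] -/
@[simp] theorem e64_apply_zero (hp2 : p ≠ 2) (ρ : Fin 3 → ZMod p) : e64 hp2 ρ 0 = ρ 0 := by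
  simp [e64]
/-- `e64_apply_one` (auxiliary). [folklore] -/
@[simp] theorem e64_apply_one (hp2 : p ≠ 2) (ρ : Fin 3 → ZMod p) : e64 hp2 ρ 1 = (64 : ZMod p)⁻¹ * ρ 1 := by
  simp [e64]
/-- `e64_apply_two` (auxiliary). [folklore] -/
@[simp] theorem e64_apply_two (hp2 : p ≠ 2) (ρ : Fin 3 → ZMod p) : e64 hp2 ρ 2 = ρ 2 := by
  simp [e64]

/-- `e64` is additive. [folklore] -/
theorem e64_sub (hp2 : p ≠ 2) (ρ μ : Fin 3 → ZMod p) : e64 hp2 (ρ - μ) = e64 hp2 ρ - e64 hp2 μ := by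
  funext i
  fin_cases i <;> simp [e64, mul_sub]

/-- `e64_neg` (auxiliary). [folklore] -/
theorem e64_neg (hp2 : p ≠ 2) (μ : Fin 3 → ZMod p) : e64 hp2 (-μ) = -e64 hp2 μ := by
  have := e64_sub hp2 0 μ
  simp only [zero_sub] at this
  rw [this]
  have h0 : e64 hp2 0 = 0 := by funext i; fin_cases i <;> simp [e64]
  rw [h0, zero_sub]

/-- `Δ(ρ) = 128 · n₃₂(e64 ρ)` (`128 · 32 = 64²`). [folklore] -/
theorem ΔF_eq (hp2 : p ≠ 2) (ρ : Fin 3 → ZMod p) : ΔF ρ = 128 * nF32 (e64 hp2 ρ) := by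
  have h64 := c64_ne_zero_zmod (p := p) hp2
  simp only [ΔF, nF32, e64_apply_zero, e64_apply_one, e64_apply_two]
  field_simp
  ring

/-- `Ω_p(ρ) = coneSymF32 (e64 ρ)`. [folklore] -/
theorem kohnenSymF_eq (hp2 : p ≠ 2) (ρ : Fin 3 → ZMod p) : kohnenSymF ρ = coneSymF32 (e64 hp2 ρ) := by
  have h128 : (128 : ZMod p) ≠ 0 := c128_ne_zero_zmod (p := p) hp2
  have hiff : ΔF ρ = 0 ↔ nF32 (e64 hp2 ρ) = 0 := by
    rw [ΔF_eq hp2]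
    constructor
    · intro h; exact (mul_eq_zero.mp h).resolve_left h128
    · intro h; rw [h, mul_zero]
  unfold kohnenSymF coneSymF32
  simp only [hiff, e64_apply_zero, e64_apply_two]

/-- **The cone Gauss sum at an odd prime for Kohnen's symbol** (`t ≠ 0`, `μ ∈ 𝔽_p³`):
`∑_{ρ ∈ 𝔽_p³} Ω_p(ρ - μ) e_p(t · Δ(ρ)) = Ω_p(-μ) · p · G(t; p)`. [folklore] -/
theorem sum_kohnenSymF_sub_mul_ψ (hp2 : p ≠ 2) {t : ZMod p} (ht : t ≠ 0) (μ : Fin 3 → ZMod p) :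
    ∑ ρ : Fin 3 → ZMod p, kohnenSymF (ρ - μ) * ψp p (t * ΔF ρ) =
      kohnenSymF (-μ) * p * quadGaussSum p t 0 := by
  have h128 : (128 : ZMod p) ≠ 0 := c128_ne_zero_zmod (p := p) hp2
  have h64 := c64_ne_zero_zmod (p := p) hp2
  set e := e64 (p := p) hp2 with he
  -- reindex by `e`
  have step : ∑ ρ : Fin 3 → ZMod p, kohnenSymF (ρ - μ) * ψp p (t * ΔF ρ) =
      ∑ ρ' : Fin 3 → ZMod p, coneSymF32 (ρ' - e μ) * ψp p ((128 * t) * nF32 ρ') := by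
    refine Fintype.sum_equiv e _ _ fun ρ ↦ ?_
    rw [kohnenSymF_eq hp2, ← he, e64_sub, ΔF_eq hp2, ← he]
    ring_nf
  rw [step, sum_coneSymF32_sub_mul_ψ hp2 (mul_ne_zero h128 ht) (e μ), ← e64_neg, ← he,
    ← kohnenSymF_eq hp2]
  -- `G(32 · 128 t) = G(64² t) = G(t)`
  have hG : quadGaussSum p (32 * (128 * t)) 0 = quadGaussSum p t 0 := by
    rw [show (32 : ZMod p) * (128 * t) = (64 : ZMod p) ^ 2 * t by ring]
    exact quadGaussSum_unit_sq_mul (IsUnit.mk0 _ h64) t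
  rw [hG]

end FiniteField

/-! ### Cone sums modulo a general `M` for `Δ`: multiplicativity and the `2`-part -/

section General

open Literature.NumberTheory.LFunctions (stdAddChar_eq_mul_of_coprime)

variable {M : ℕ} [NeZero M]

/-- `Δ(r) = r₁² - 128 r₀ r₂` on `(ℤ/M)³`. [folklore] -/
def nZK (r : Fin 3 → ZMod M) : ZMod M := r 1 ^ 2 - 128 * r 0 * r 2

/-- The weighted quadratic sum `∑_{r ∈ (ℤ/M)³} W(r) e_M(t · Δ(r))`. [folklore] -/
def coneSumK (M : ℕ) [NeZero M] (W : (Fin 3 → ZMod M) → ℂ) (t : ZMod M) : ℂ :=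
  ∑ r : Fin 3 → ZMod M, W r * ZMod.stdAddChar (t * nZK r)

omit [NeZero M] in
/-- `Δ` commutes with ring homomorphisms. [folklore] -/
theorem map_nZK {M₁ : ℕ} (f : ZMod M →+* ZMod M₁) (r : Fin 3 → ZMod M) :
    f (nZK r) = nZK (fun i ↦ f (r i)) := by
  simp only [nZK, map_sub, map_mul, map_pow, map_ofNat]

/-- **Multiplicativity of the cone sums** (CRT). [folklore] -/
theorem coneSumK_mul_of_coprime {M₁ M₂ : ℕ} [NeZero M₁] [NeZero M₂] [NeZero (M₁ * M₂)]
    (h : M₁.Coprime M₂) (W₁ : (Fin 3 → ZMod M₁) → ℂ) (W₂ : (Fin 3 → ZMod M₂) → ℂ)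
    (t : ZMod (M₁ * M₂)) :
    coneSumK (M₁ * M₂) (fun r ↦ W₁ (fun i ↦ ZMod.castHom (dvd_mul_right M₁ M₂) (ZMod M₁) (r i)) *
        W₂ (fun i ↦ ZMod.castHom (dvd_mul_left M₂ M₁) (ZMod M₂) (r i))) t =
      coneSumK M₁ W₁ ((M₂ : ZMod M₁)⁻¹ * ZMod.castHom (dvd_mul_right M₁ M₂) (ZMod M₁) t) *
        coneSumK M₂ W₂ ((M₁ : ZMod M₂)⁻¹ * ZMod.castHom (dvd_mul_left M₂ M₁) (ZMod M₂) t) := by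
  classical
  rw [coneSumK, coneSumK, coneSumK, Finset.sum_mul_sum, ← Fintype.sum_prod_type']
  refine Fintype.sum_equiv (crt3 h) _ _ fun r ↦ ?_
  have e1 : (crt3 h r).1 = fun i ↦ ZMod.castHom (dvd_mul_right M₁ M₂) (ZMod M₁) (r i) :=
    funext fun i ↦ crt3_fst h r i
  have e2 : (crt3 h r).2 = fun i ↦ ZMod.castHom (dvd_mul_left M₂ M₁) (ZMod M₂) (r i) :=
    funext fun i ↦ crt3_snd h r i
  have h1 : ZMod.castHom (dvd_mul_right M₁ M₂) (ZMod M₁) (t * nZK r) =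
      ZMod.castHom (dvd_mul_right M₁ M₂) (ZMod M₁) t *
        nZK (fun i ↦ ZMod.castHom (dvd_mul_right M₁ M₂) (ZMod M₁) (r i)) := by
    rw [map_mul, map_nZK]
  have h2 : ZMod.castHom (dvd_mul_left M₂ M₁) (ZMod M₂) (t * nZK r) =
      ZMod.castHom (dvd_mul_left M₂ M₁) (ZMod M₂) t *
        nZK (fun i ↦ ZMod.castHom (dvd_mul_left M₂ M₁) (ZMod M₂) (r i)) := by
    rw [map_mul, map_nZK]
  rw [e1, e2, stdAddChar_eq_mul_of_coprime h (t * nZK r), h1, h2]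
  ring_nf

end General

/-- **The `2`-part with trivial weight at `M = 128`**: `∑_{r ∈ (ℤ/128)³} e_128(t Δ(r)) = 128² G(t; 128)`
(`128 r₀ r₂ ≡ 0`, so `r₀, r₂` are free). [folklore] -/
theorem coneSumK_one_128 (t : ZMod 128) :
    coneSumK 128 (fun _ ↦ (1 : ℂ)) t = (128 : ℂ) ^ 2 * quadGaussSum 128 t 0 := by
  classical
  haveI : NeZero (128 : ℕ) := ⟨by norm_num⟩
  rw [coneSumK, sum_vecM]
  have h128 : (128 : ZMod 128) = 0 := by decide
  have hterm : ∀ a b c : ZMod 128, (1 : ℂ) * ZMod.stdAddChar (t * nZK (vecM a b c)) =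
      ZMod.stdAddChar (t * b ^ 2) := by
    intro a b c
    simp only [nZK, vecM_zero, vecM_one, vecM_two, h128, zero_mul, sub_zero, one_mul]
  simp_rw [hterm]
  rw [Finset.sum_comm]
  simp_rw [Finset.sum_const, Finset.card_univ, ZMod.card, nsmul_eq_mul]
  rw [quadGaussSum_def]
  simp_rw [zero_mul, add_zero]
  rw [Finset.mul_sum]
  refine Finset.sum_congr rfl fun b _ ↦ ?_
  push_cast
  ring

/-! ### The weight on residues and the `D`-part -/

section DPart

/-- Kohnen's symbol of a residue vector mod `p`. [folklore] -/
def kohnenSymZ (p : ℕ) (ρ : Fin 3 → ZMod p) : ℤ := kohnenSym p (liftZ ρ)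

/-- **Bridge**: `Ω_p` of `𝔽_p³` (`kohnenSymF`) is the integer symbol of the lift. [folklore] -/
theorem kohnenSymZ_eq_kohnenSymF {p : ℕ} [hp : Fact p.Prime] (ρ : Fin 3 → ZMod p) :
    (kohnenSymZ p ρ : ℂ) = kohnenSymF ρ := by
  unfold kohnenSymZ kohnenSym kohnenSymF liftZ
  have hcast : ∀ i, (((ρ i).val : ℕ) : ZMod p) = ρ i := fun i ↦ ZMod.natCast_zmod_val (ρ i)
  have hcast' : ∀ i, (((ρ i).val : ℤ) : ZMod p) = ρ i := fun i ↦ by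
    rw [Int.cast_natCast, hcast]
  have e1 : ((p : ℤ) ∣ discK (fun i ↦ ((ρ i).val : ℤ))) ↔ ΔF ρ = 0 := by
    rw [← intCast_zmod_eq_zero_iff (p := p)]
    unfold discK ΔF
    push_cast
    rw [hcast 0, hcast 1, hcast 2]
  have e2 : ((p : ℤ) ∣ ((ρ 0).val : ℤ)) ↔ ρ 0 = 0 := by
    rw [← intCast_zmod_eq_zero_iff (p := p), hcast' 0]
  by_cases hn : ΔF ρ = 0
  · rw [if_pos (e1.mpr hn), if_pos hn]
    by_cases h0 : ρ 0 = 0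
    · rw [if_pos (e2.mpr h0), if_pos h0, jacobiSym_eq_quadraticChar, χc_apply, hcast' 2]
    · rw [if_neg (mt e2.mp h0), if_neg h0, jacobiSym_eq_quadraticChar, χc_apply]
      push_cast
      rw [hcast 0]
  · rw [if_neg (mt e1.mp hn), if_neg hn, Int.cast_zero]

/-- The symbol of an integer vector is that of its residue. [folklore] -/
theorem kohnenSym_eq_kohnenSymZ (p : ℕ) [NeZero p] (k : Fin 3 → ℤ) :
    kohnenSym p k = kohnenSymZ p (fun i ↦ (k i : ZMod p)) := by
  unfold kohnenSymZ liftZ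
  refine kohnenSym_congr (M := p) (dvd_refl _) fun i ↦ ?_
  rw [Int.ModEq, ZMod.val_intCast, Int.emod_emod_of_dvd _ (dvd_refl _)]

/-- The symbol of a residue vector mod `M` (with `p ∣ M`) depends only on its image mod `p`. [folklore] -/
theorem kohnenSym_liftZ_eq {p M : ℕ} [NeZero M] [NeZero p] (r : Fin 3 → ZMod M) :
    kohnenSym p (liftZ r) = kohnenSymZ p (fun i ↦ ((r i).cast : ZMod p)) := by
  unfold kohnenSymZ liftZ
  refine kohnenSym_congr (M := p) (dvd_refl _) fun i ↦ ?_
  show ((r i).val : ℤ) ≡ ((((r i).cast : ZMod p)).val : ℤ) [ZMOD p]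
  rw [ZMod.cast_eq_val, ZMod.val_natCast, Int.ModEq]
  push_cast
  rw [Int.emod_emod_of_dvd _ (dvd_refl _)]

/-- **The weight on residues**: `w_D(r) = ∏_{p ∣ D} Ω_p(r mod p)` for `r ∈ (ℤ/M)³`. [folklore] -/
def wDK (D : ℕ) {M : ℕ} (r : Fin 3 → ZMod M) : ℂ :=
  ((∏ p ∈ D.primeFactors, kohnenSymZ p (fun i ↦ ((r i).cast : ZMod p)) : ℤ) : ℂ)

/-- `w_D` is compatible with reduction (`D ∣ M₁ ∣ M`). [folklore] -/
theorem wDK_castHom {D M M₁ : ℕ} [NeZero M] (hDM : D ∣ M₁) (h : M₁ ∣ M) (r : Fin 3 → ZMod M) :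
    wDK D r = wDK D (fun i ↦ ZMod.castHom h (ZMod M₁) (r i)) := by
  haveI : NeZero M₁ := ⟨fun h0 ↦ by subst h0; exact NeZero.ne M (Nat.eq_zero_of_zero_dvd h)⟩
  unfold wDK
  congr 1
  refine Finset.prod_congr rfl fun p hp ↦ ?_
  have hpD : p ∣ D := Nat.dvd_of_mem_primeFactors hp
  congr 1
  funext i
  show (ZMod.castHom (dvd_trans (dvd_trans hpD hDM) h) (ZMod p)) (r i) =
    (ZMod.castHom (dvd_trans hpD hDM) (ZMod p)) ((ZMod.castHom h (ZMod M₁)) (r i))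
  rw [← RingHom.comp_apply (ZMod.castHom (dvd_trans hpD hDM) (ZMod p)), ZMod.castHom_comp]

/-- **Multiplicativity of `w`** for coprime `a, b`. [folklore] -/
theorem wDK_mul {a b M : ℕ} (hab : a.Coprime b) (ha : a ≠ 0) (hb : b ≠ 0) (r : Fin 3 → ZMod M) :
    wDK (a * b) r = wDK a r * wDK b r := by
  unfold wDK
  rw [Nat.primeFactors_mul ha hb, Finset.prod_union hab.disjoint_primeFactors, Int.cast_mul]

/-- `w_p = Ω_p` for a prime `p` (auxiliary). [folklore] -/
theorem wDK_prime {p : ℕ} [hp : Fact p.Prime] (r : Fin 3 → ZMod p) : wDK p r = kohnenSymF r := by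
  unfold wDK
  rw [Nat.Prime.primeFactors hp.out, Finset.prod_singleton, kohnenSymZ_eq_kohnenSymF]
  congr 1
  funext i
  exact ZMod.cast_id p (r i)

/-- `wDK_one` (auxiliary). [folklore] -/
theorem wDK_one {M : ℕ} (r : Fin 3 → ZMod M) : wDK 1 r = 1 := by
  simp [wDK]

/-- `|w_D(r)| ≤ 1`. [folklore] -/
theorem norm_wDK_le (D : ℕ) {M : ℕ} (r : Fin 3 → ZMod M) : ‖wDK D r‖ ≤ 1 := by
  unfold wDK
  rw [← Complex.ofReal_intCast, Complex.norm_real, Real.norm_eq_abs, Int.cast_prod, Finset.abs_prod]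
  refine Finset.prod_le_one (fun _ _ ↦ abs_nonneg _) fun p _ ↦ ?_
  unfold kohnenSymZ
  exact_mod_cast abs_kohnenSym_le p _

/-- The predicate proved by induction over square-free `D`. [folklore] -/
def DPartPropK (D : ℕ) : Prop :=
  ∀ [NeZero D], Squarefree D → Odd D → ∀ (t : ZMod D), IsUnit t → ∀ u : Fin 3 → ZMod D,
    coneSumK D (fun r ↦ wDK D (r - u)) t = wDK D (-u) * D * quadGaussSum D t 0

/-- `dPartPropK_one` (auxiliary). [folklore] -/
theorem dPartPropK_one : DPartPropK 1 := by
  intro _ _ _ t _ u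
  rw [wDK_one, one_mul, coneSumK, quadGaussSum_eq_one_of_eq_one rfl, Nat.cast_one, mul_one]
  have : ∀ r : Fin 3 → ZMod 1, wDK 1 (r - u) * ZMod.stdAddChar (t * nZK r) = 1 := by
    intro r
    rw [wDK_one, one_mul]
    have : t * nZK r = 0 := Subsingleton.elim _ _
    rw [this, AddChar.map_zero_eq_one]
  simp_rw [this]
  rw [Finset.sum_const, Finset.card_univ, nsmul_eq_mul, mul_one]
  simp

/-- `dPartPropK_prime` (auxiliary). [folklore] -/
theorem dPartPropK_prime {p : ℕ} (hp : p.Prime) : DPartPropK p := by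
  intro _ _ hodd t ht u
  haveI := Fact.mk hp
  have hp2 : p ≠ 2 := by rintro rfl; exact (Nat.not_even_iff_odd.mpr hodd) even_two
  have ht0 : t ≠ 0 := ht.ne_zero
  rw [show (fun r : Fin 3 → ZMod p ↦ wDK p (r - u)) = fun r ↦ kohnenSymF (r - u) from
    funext fun r ↦ wDK_prime _, wDK_prime, coneSumK]
  exact sum_kohnenSymF_sub_mul_ψ hp2 ht0 u

/-- `dPartPropK_mul` (auxiliary). [folklore] -/
theorem dPartPropK_mul {a b : ℕ} (h1a : 1 < a) (h1b : 1 < b) (hab : a.Coprime b)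
    (ha : DPartPropK a) (hb : DPartPropK b) : DPartPropK (a * b) := by
  intro _ hsq hodd t ht u
  haveI : NeZero a := ⟨by omega⟩
  haveI : NeZero b := ⟨by omega⟩
  have hsqa : Squarefree a := hsq.of_mul_left
  have hsqb : Squarefree b := hsq.of_mul_right
  have hodda : Odd a := (Nat.odd_mul.mp hodd).1
  have hoddb : Odd b := (Nat.odd_mul.mp hodd).2
  set ua : Fin 3 → ZMod a := fun i ↦ ZMod.castHom (dvd_mul_right a b) (ZMod a) (u i) with hua'
  set ub : Fin 3 → ZMod b := fun i ↦ ZMod.castHom (dvd_mul_left b a) (ZMod b) (u i) with hub'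
  set W₁ : (Fin 3 → ZMod a) → ℂ := fun ρ ↦ wDK a (ρ - ua) with hW₁
  set W₂ : (Fin 3 → ZMod b) → ℂ := fun ρ ↦ wDK b (ρ - ub) with hW₂
  have hW : (fun r : Fin 3 → ZMod (a * b) ↦ wDK (a * b) (r - u)) = fun r ↦
      W₁ (fun i ↦ ZMod.castHom (dvd_mul_right a b) (ZMod a) (r i)) *
      W₂ (fun i ↦ ZMod.castHom (dvd_mul_left b a) (ZMod b) (r i)) := by
    funext r
    rw [wDK_mul hab (by omega) (by omega),
      wDK_castHom (dvd_refl a) (dvd_mul_right a b), wDK_castHom (dvd_refl b) (dvd_mul_left b a)]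
    simp only [hW₁, hW₂, hua', hub', Pi.sub_apply, map_sub]
    rfl
  rw [hW, coneSumK_mul_of_coprime hab W₁ W₂ t]
  have hbu : IsUnit (b : ZMod a) := (ZMod.isUnit_iff_coprime b a).mpr hab.symm
  have hau : IsUnit (a : ZMod b) := (ZMod.isUnit_iff_coprime a b).mpr hab
  have hbinv : IsUnit ((b : ZMod a)⁻¹) := IsUnit.of_mul_eq_one (b : ZMod a) (ZMod.inv_mul_of_unit _ hbu)
  have hainv : IsUnit ((a : ZMod b)⁻¹) := IsUnit.of_mul_eq_one (a : ZMod b) (ZMod.inv_mul_of_unit _ hau)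
  have hta : IsUnit ((b : ZMod a)⁻¹ * ZMod.castHom (dvd_mul_right a b) (ZMod a) t) :=
    hbinv.mul (ht.map _)
  have htb : IsUnit ((a : ZMod b)⁻¹ * ZMod.castHom (dvd_mul_left b a) (ZMod b) t) :=
    hainv.mul (ht.map _)
  rw [show coneSumK a W₁ _ = _ from ha hsqa hodda _ hta ua,
    show coneSumK b W₂ _ = _ from hb hsqb hoddb _ htb ub]
  have hw : wDK (a * b) (-u) = wDK a (-ua) * wDK b (-ub) := by
    rw [wDK_mul hab (by omega) (by omega),
      wDK_castHom (dvd_refl a) (dvd_mul_right a b), wDK_castHom (dvd_refl b) (dvd_mul_left b a)]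
    simp only [hua', hub', Pi.neg_apply, map_neg]
    rfl
  have htval : t = ((t.val : ℕ) : ZMod (a * b)) := (ZMod.natCast_zmod_val t).symm
  have hG := quadGaussSum_mul_of_coprime hab (t.val : ℤ)
  have e0 : ((t.val : ℤ) : ZMod (a * b)) = t := by
    push_cast; rw [ZMod.natCast_zmod_val]
  have ea : ((b * (t.val : ℤ) : ℤ) : ZMod a) =
      (b : ZMod a) ^ 2 * ((b : ZMod a)⁻¹ * ZMod.castHom (dvd_mul_right a b) (ZMod a) t) := by
    rw [ZMod.castHom_apply, ZMod.cast_eq_val, htval]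
    rw [ZMod.val_natCast, Nat.mod_eq_of_lt (ZMod.val_lt t)]
    push_cast
    have : (b : ZMod a) * (b : ZMod a)⁻¹ = 1 := ZMod.mul_inv_of_unit _ hbu
    linear_combination (-((t.val : ZMod a) * (b : ZMod a))) * this
  have eb : ((a * (t.val : ℤ) : ℤ) : ZMod b) =
      (a : ZMod b) ^ 2 * ((a : ZMod b)⁻¹ * ZMod.castHom (dvd_mul_left b a) (ZMod b) t) := by
    rw [ZMod.castHom_apply, ZMod.cast_eq_val, htval]
    rw [ZMod.val_natCast, Nat.mod_eq_of_lt (ZMod.val_lt t)]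
    push_cast
    have : (a : ZMod b) * (a : ZMod b)⁻¹ = 1 := ZMod.mul_inv_of_unit _ hau
    linear_combination (-((t.val : ZMod b) * (a : ZMod b))) * this
  rw [e0, ea, eb, quadGaussSum_unit_sq_mul hbu, quadGaussSum_unit_sq_mul hau] at hG
  rw [hw, hG]
  push_cast
  ring

/-- **The `D`-part of the cone Gauss sum for `Δ`** (`D` odd square-free, `t` a unit mod `D`):
`∑_{r ∈ (ℤ/D)³} w_D(r - u) e_D(t Δ(r)) = w_D(-u) · D · G(t; D)`. [folklore] -/
theorem dPartPropK_all (D : ℕ) : DPartPropK D := by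
  induction D using Nat.recOnPosPrimePosCoprime with
  | prime_pow p n hp hn =>
    rcases Nat.lt_or_ge 1 n with h2 | h2
    · intro _ hsq
      exfalso
      have hdvd : p * p ∣ p ^ n := by
        rw [← sq]; exact pow_dvd_pow p h2
      have := hsq p hdvd
      rw [Nat.isUnit_iff] at this
      exact hp.one_lt.ne' this
    · have hn1 : n = 1 := by omega
      subst hn1
      rw [pow_one]
      exact @dPartPropK_prime p hp
  | zero => intro _ hsq; exact absurd hsq not_squarefree_zero
  | one => exact dPartPropK_one
  | coprime a b ha hb hab iha ihb => exact dPartPropK_mul ha hb hab iha ihb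

/-! ### The cone Gauss sum `(★K)` modulo `N = 128 D` -/

/-- **The cone Gauss sum `(★K)`** (`D` odd square-free, `N = 128 D`, `a` a unit mod `N`,
`u ∈ (ℤ/N)³`): `∑_{r ∈ (ℤ/N)³} w_D(r - u) e_N(a · Δ(r)) = w_D(-u) · 128 N · G(a; N)`. [folklore] -/
theorem coneSumK_wDK {D : ℕ} [NeZero D] (hsq : Squarefree D) (hodd : Odd D)
    (a : ZMod (128 * D)) (ha : IsUnit a) (u : Fin 3 → ZMod (128 * D)) :
    coneSumK (128 * D) (fun r ↦ wDK D (r - u)) a =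
      wDK D (-u) * (128 * (128 * D : ℕ)) * quadGaussSum (128 * D) a 0 := by
  have hcop : Nat.Coprime 128 D := coprime_128_of_odd hodd
  haveI : NeZero (128 * D) := ⟨mul_ne_zero (by norm_num) (NeZero.ne D)⟩
  haveI : NeZero (128 : ℕ) := ⟨by norm_num⟩
  set π₁ := ZMod.castHom (dvd_mul_right 128 D) (ZMod 128) with hπ₁
  set π₂ := ZMod.castHom (dvd_mul_left D 128) (ZMod D) with hπ₂
  set u₂ : Fin 3 → ZMod D := fun i ↦ π₂ (u i) with hu₂
  set W₁ : (Fin 3 → ZMod 128) → ℂ := fun _ ↦ 1 with hW₁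
  set W₂ : (Fin 3 → ZMod D) → ℂ := fun ρ ↦ wDK D (ρ - u₂) with hW₂
  have hW : (fun r : Fin 3 → ZMod (128 * D) ↦ wDK D (r - u)) = fun r ↦
      W₁ (fun i ↦ ZMod.castHom (dvd_mul_right 128 D) (ZMod 128) (r i)) *
      W₂ (fun i ↦ ZMod.castHom (dvd_mul_left D 128) (ZMod D) (r i)) := by
    funext r
    rw [wDK_castHom (dvd_refl D) (dvd_mul_left D 128)]
    simp only [hW₁, hW₂, hu₂, Pi.sub_apply, map_sub, one_mul]
    rfl
  rw [hW, coneSumK_mul_of_coprime hcop W₁ W₂ a]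
  have hDu : IsUnit ((D : ℕ) : ZMod 128) := (ZMod.isUnit_iff_coprime D 128).mpr hcop.symm
  have h128u : IsUnit ((128 : ℕ) : ZMod D) := (ZMod.isUnit_iff_coprime 128 D).mpr hcop
  have h128u' : IsUnit (128 : ZMod D) := by have := h128u; push_cast at this; exact this
  have h128inv : IsUnit (((128 : ℕ) : ZMod D)⁻¹) := IsUnit.of_mul_eq_one ((128 : ℕ) : ZMod D)
    (ZMod.inv_mul_of_unit _ h128u)
  have ht₂ : IsUnit ((((128 : ℕ) : ZMod D))⁻¹ * π₂ a) := h128inv.mul (ha.map _)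
  have hS₁ : coneSumK 128 W₁ ((D : ZMod 128)⁻¹ * π₁ a) =
      (128 : ℂ) ^ 2 * quadGaussSum 128 ((D : ZMod 128)⁻¹ * π₁ a) 0 := by
    rw [hW₁]; exact coneSumK_one_128 _
  have hS₂ : coneSumK D W₂ ((((128 : ℕ) : ZMod D))⁻¹ * π₂ a) =
      wDK D (-u₂) * D * quadGaussSum D ((((128 : ℕ) : ZMod D))⁻¹ * π₂ a) 0 :=
    dPartPropK_all D hsq hodd _ ht₂ u₂
  rw [show ((128 : ℕ) : ZMod D) = (128 : ZMod D) by push_cast; rfl] at hS₂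
  rw [hS₁]
  erw [hS₂]
  have hw : wDK D (-u) = wDK D (-u₂) := by
    rw [wDK_castHom (dvd_refl D) (dvd_mul_left D 128)]
    simp only [hu₂, Pi.neg_apply, map_neg]
    rfl
  -- Gauss sums: `G(a; 128D) = G(Da; 128) G(128a; D)` and unit squares
  have hG := quadGaussSum_mul_of_coprime hcop (a.val : ℤ)
  push_cast at hG
  have e0 : ((a.val : ℕ) : ZMod (128 * D)) = a := ZMod.natCast_zmod_val a
  have hπ₁a : π₁ a = ((a.val : ℕ) : ZMod 128) := by rw [hπ₁, ZMod.castHom_apply, ZMod.cast_eq_val]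
  have hπ₂a : π₂ a = ((a.val : ℕ) : ZMod D) := by rw [hπ₂, ZMod.castHom_apply, ZMod.cast_eq_val]
  have ea : (D : ZMod 128) * ((a.val : ℕ) : ZMod 128) =
      (D : ZMod 128) ^ 2 * ((D : ZMod 128)⁻¹ * π₁ a) := by
    rw [hπ₁a]
    have : (D : ZMod 128) * (D : ZMod 128)⁻¹ = 1 := ZMod.mul_inv_of_unit _ hDu
    linear_combination (-(((a.val : ℕ) : ZMod 128) * (D : ZMod 128))) * this
  have eb : (128 : ZMod D) * ((a.val : ℕ) : ZMod D) =
      (128 : ZMod D) ^ 2 * ((128 : ZMod D)⁻¹ * π₂ a) := by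
    rw [hπ₂a]
    have : (128 : ZMod D) * (128 : ZMod D)⁻¹ = 1 := ZMod.mul_inv_of_unit _ h128u'
    linear_combination (-(((a.val : ℕ) : ZMod D) * (128 : ZMod D))) * this
  rw [e0, ea, eb, quadGaussSum_unit_sq_mul hDu, quadGaussSum_unit_sq_mul h128u'] at hG
  rw [hw, hG]
  push_cast
  ring

/-- **Bridge to the integer weight**: for `D ∣ M`, `kohnenWt D k = w_D(k mod M)`. [folklore] -/
theorem kohnenWt_eq_wDK {D M : ℕ} [NeZero M] (hDM : D ∣ M) (k : Fin 3 → ℤ) :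
    (kohnenWt D k : ℂ) = wDK D (fun i ↦ (k i : ZMod M)) := by
  unfold kohnenWt wDK
  congr 1
  refine Finset.prod_congr rfl fun p hp ↦ ?_
  haveI : NeZero p := ⟨(Nat.prime_of_mem_primeFactors hp).ne_zero⟩
  have hpM : p ∣ M := dvd_trans (Nat.dvd_of_mem_primeFactors hp) hDM
  rw [kohnenSym_eq_kohnenSymZ p k]
  congr 2
  funext i
  rw [ZMod.cast_intCast hpM]

/-! ### Evaluation of the Gauss coefficient sums at `c = 128` -/

/-- The polar form of `Δ` on `(ℤ/M)³`: `B(r, u) = 2 r₁ u₁ - 128 (r₀ u₂ + r₂ u₀)`. [folklore] -/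
def bZK {M : ℕ} (r u : Fin 3 → ZMod M) : ZMod M := 2 * r 1 * u 1 - 128 * (r 0 * u 2 + r 2 * u 0)

/-- `nZK_add` (auxiliary). [folklore] -/
theorem nZK_add {M : ℕ} (r u : Fin 3 → ZMod M) : nZK (r + u) = nZK r + bZK r u + nZK u := by
  simp only [nZK, bZK, Pi.add_apply]; ring

/-- The shift vector with `x` at coordinate `i`. [folklore] -/
def shiftVec {M : ℕ} (i : Fin 3) (x : ZMod M) : Fin 3 → ZMod M := fun j ↦ if j = i then x else 0

/-- `w_D` is invariant under shifts by multiples of `D` (`N = 128D`). [folklore] -/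
theorem wDK_add_shift {D : ℕ} [NeZero D] (i : Fin 3) (m : ℤ) (r : Fin 3 → ZMod (128 * D)) :
    wDK D (r + shiftVec i ((m * D : ℤ) : ZMod (128 * D))) = wDK D r := by
  unfold wDK
  congr 1
  refine Finset.prod_congr rfl fun p hp ↦ ?_
  have hpD : p ∣ D := Nat.dvd_of_mem_primeFactors hp
  congr 1
  funext j
  simp only [Pi.add_apply, shiftVec]
  split_ifs with hj
  · rw [ZMod.cast_add (dvd_mul_of_dvd_right hpD 128), ZMod.cast_intCast (dvd_mul_of_dvd_right hpD 128)]
    push_cast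
    rw [(ZMod.natCast_eq_zero_iff D p).mpr hpD, mul_zero, add_zero]
  · rw [add_zero]

/-- `Δ` is invariant mod `N = 128D` under `r₀ ↦ r₀ + D`. [folklore] -/
theorem nZK_add_shift_zero {D : ℕ} [NeZero D] (r : Fin 3 → ZMod (128 * D)) :
    nZK (r + shiftVec 0 (((1 : ℤ) * D : ℤ) : ZMod (128 * D))) = nZK r := by
  have hN : ((128 * D : ℕ) : ZMod (128 * D)) = 0 := ZMod.natCast_self _
  simp only [nZK, Pi.add_apply, shiftVec, if_true, show (1 : Fin 3) ≠ 0 by decide,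
    show (2 : Fin 3) ≠ 0 by decide, if_false, add_zero]
  push_cast at hN ⊢
  linear_combination (-(r 2)) * hN

/-- `Δ` is invariant mod `N = 128D` under `r₂ ↦ r₂ + D`. [folklore] -/
theorem nZK_add_shift_two {D : ℕ} [NeZero D] (r : Fin 3 → ZMod (128 * D)) :
    nZK (r + shiftVec 2 (((1 : ℤ) * D : ℤ) : ZMod (128 * D))) = nZK r := by
  have hN : ((128 * D : ℕ) : ZMod (128 * D)) = 0 := ZMod.natCast_self _
  simp only [nZK, Pi.add_apply, shiftVec, if_true, show (0 : Fin 3) ≠ 2 by decide,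
    show (1 : Fin 3) ≠ 2 by decide, if_false, add_zero]
  push_cast at hN ⊢
  linear_combination (-(r 0)) * hN

/-- `Δ` is invariant mod `N = 128D` under `r₁ ↦ r₁ + 64D`. [folklore] -/
theorem nZK_add_shift_one {D : ℕ} [NeZero D] (r : Fin 3 → ZMod (128 * D)) :
    nZK (r + shiftVec 1 (((64 : ℤ) * D : ℤ) : ZMod (128 * D))) = nZK r := by
  have hN : ((128 * D : ℕ) : ZMod (128 * D)) = 0 := ZMod.natCast_self _
  simp only [nZK, Pi.add_apply, shiftVec, if_true, show (0 : Fin 3) ≠ 1 by decide,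
    show (2 : Fin 3) ≠ 1 by decide, if_false, add_zero]
  push_cast at hN ⊢
  linear_combination (r 1 + 32 * D) * hN

/-- `ellZ` under the three shifts. [folklore] -/
theorem ellZ_add_shiftVec {D : ℕ} [NeZero D] (i : Fin 3) (x : ZMod (128 * D))
    (r : Fin 3 → ZMod (128 * D)) (k : Fin 3 → ℤ) :
    ellZ (r + shiftVec i x) k = ellZ r k + ellZ (shiftVec i x) k := by
  simp only [ellZ, Pi.add_apply]; ring

/-- The generic shift argument: an invariant sum acquiring a non-trivial phase vanishes. [folklore] -/
theorem sum_eq_zero_of_shift {N : ℕ} [NeZero N] (F : (Fin 3 → ZMod N) → ℂ) (s : Fin 3 → ZMod N)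
    (c : ℂ) (hc : c ≠ 1) (hF : ∀ r, F (r + s) = c * F r) : ∑ r : Fin 3 → ZMod N, F r = 0 := by
  set S := ∑ r : Fin 3 → ZMod N, F r with hS
  have h1 : S = ∑ r : Fin 3 → ZMod N, F (r + s) :=
    (Fintype.sum_equiv (Equiv.addRight s) (fun r ↦ F (r + s)) F (fun _ ↦ rfl)).symm
  have h2 : S = c * S := by
    conv_lhs => rw [h1]
    rw [hS, Finset.mul_sum]
    exact Finset.sum_congr rfl fun r _ ↦ hF r
  have : (1 - c) * S = 0 := by linear_combination h2
  rcases mul_eq_zero.mp this with h | h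
  · exact absurd (sub_eq_zero.mp h).symm hc
  · exact h

/-- `ψ_{128D}(D m) = 1` only if `128 ∣ m`. [folklore] -/
theorem stdAddChar_D_mul_ne_one {D : ℕ} [NeZero D] {m : ℤ} (hm : ¬ (128 : ℤ) ∣ m) :
    (ZMod.stdAddChar (((D : ℤ) * m : ℤ) : ZMod (128 * D)) : ℂ) ≠ 1 := by
  intro h
  have h0 : (((D : ℤ) * m : ℤ) : ZMod (128 * D)) = 0 := by
    have h' : (ZMod.stdAddChar (((D : ℤ) * m : ℤ) : ZMod (128 * D)) : ℂ) =
        ZMod.stdAddChar (0 : ZMod (128 * D)) := by rw [h, AddChar.map_zero_eq_one]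
    rw [ZMod.stdAddChar_apply, ZMod.stdAddChar_apply] at h'
    exact ZMod.injective_toCircle (Subtype.ext h')
  rw [ZMod.intCast_zmod_eq_zero_iff_dvd] at h0
  apply hm
  obtain ⟨q, hq⟩ := h0
  have hD : (D : ℤ) ≠ 0 := by exact_mod_cast NeZero.ne D
  refine ⟨q, ?_⟩
  have : (D : ℤ) * m = (D : ℤ) * (128 * q) := by push_cast at hq; linear_combination hq
  exact mul_left_cancel₀ hD this

/-- **Off the support, I**: `∑_r w_D(r) ψ_N(aΔ(r) + ℓ(r,k)) = 0` unless `128 ∣ k₂` (shift `r₀ ↦ r₀ + D`).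
[folklore] -/
theorem sum_wDK_mul_stdAddChar_eq_zero_of_two {D : ℕ} [NeZero D] (a : ZMod (128 * D))
    (k : Fin 3 → ℤ) (hk : ¬ (128 : ℤ) ∣ k 2) :
    ∑ r : Fin 3 → ZMod (128 * D), wDK D r * ZMod.stdAddChar (a * nZK r + ellZ r k) = 0 := by
  refine sum_eq_zero_of_shift _ (shiftVec 0 (((1 : ℤ) * D : ℤ) : ZMod (128 * D)))
    (ZMod.stdAddChar (((D : ℤ) * (-k 2) : ℤ) : ZMod (128 * D))) (stdAddChar_D_mul_ne_one (by
      intro h; exact hk (dvd_neg.mp h))) fun r ↦ ?_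
  rw [nZK_add_shift_zero, ellZ_add_shiftVec, ← add_assoc, AddChar.map_add_eq_mul,
    show wDK D (r + shiftVec 0 (((1 : ℤ) * D : ℤ) : ZMod (128 * D))) = wDK D r from wDK_add_shift 0 1 r]
  have : ellZ (shiftVec (0 : Fin 3) (((1 : ℤ) * D : ℤ) : ZMod (128 * D))) k =
      (((D : ℤ) * (-k 2) : ℤ) : ZMod (128 * D)) := by
    simp only [ellZ, shiftVec, if_true, show (1 : Fin 3) ≠ 0 by decide, show (2 : Fin 3) ≠ 0 by decide,
      if_false]
    push_cast; ring
  rw [this]; ring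

/-- **Off the support, II**: the sum vanishes unless `128 ∣ k₀` (shift `r₂ ↦ r₂ + D`). [folklore] -/
theorem sum_wDK_mul_stdAddChar_eq_zero_of_zero {D : ℕ} [NeZero D] (a : ZMod (128 * D))
    (k : Fin 3 → ℤ) (hk : ¬ (128 : ℤ) ∣ k 0) :
    ∑ r : Fin 3 → ZMod (128 * D), wDK D r * ZMod.stdAddChar (a * nZK r + ellZ r k) = 0 := by
  refine sum_eq_zero_of_shift _ (shiftVec 2 (((1 : ℤ) * D : ℤ) : ZMod (128 * D)))
    (ZMod.stdAddChar (((D : ℤ) * (-k 0) : ℤ) : ZMod (128 * D))) (stdAddChar_D_mul_ne_one (by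
      intro h; exact hk (dvd_neg.mp h))) fun r ↦ ?_
  rw [nZK_add_shift_two, ellZ_add_shiftVec, ← add_assoc, AddChar.map_add_eq_mul,
    show wDK D (r + shiftVec 2 (((1 : ℤ) * D : ℤ) : ZMod (128 * D))) = wDK D r from wDK_add_shift 2 1 r]
  have : ellZ (shiftVec (2 : Fin 3) (((1 : ℤ) * D : ℤ) : ZMod (128 * D))) k =
      (((D : ℤ) * (-k 0) : ℤ) : ZMod (128 * D)) := by
    simp only [ellZ, shiftVec, if_true, show (0 : Fin 3) ≠ 2 by decide, show (1 : Fin 3) ≠ 2 by decide,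
      if_false]
    push_cast; ring
  rw [this]; ring

/-- **Off the support, III**: the sum vanishes unless `2 ∣ k₁` (shift `r₁ ↦ r₁ + 64D`). [folklore] -/
theorem sum_wDK_mul_stdAddChar_eq_zero_of_one {D : ℕ} [NeZero D] (a : ZMod (128 * D))
    (k : Fin 3 → ℤ) (hk : ¬ (2 : ℤ) ∣ k 1) :
    ∑ r : Fin 3 → ZMod (128 * D), wDK D r * ZMod.stdAddChar (a * nZK r + ellZ r k) = 0 := by
  have hk' : ¬ (128 : ℤ) ∣ 64 * k 1 := by
    intro h; apply hk
    obtain ⟨q, hq⟩ := h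
    exact ⟨q, by linarith⟩
  refine sum_eq_zero_of_shift _ (shiftVec 1 (((64 : ℤ) * D : ℤ) : ZMod (128 * D)))
    (ZMod.stdAddChar (((D : ℤ) * (64 * k 1) : ℤ) : ZMod (128 * D))) (stdAddChar_D_mul_ne_one hk')
    fun r ↦ ?_
  rw [nZK_add_shift_one, ellZ_add_shiftVec, ← add_assoc, AddChar.map_add_eq_mul,
    show wDK D (r + shiftVec 1 (((64 : ℤ) * D : ℤ) : ZMod (128 * D))) = wDK D r from wDK_add_shift 1 64 r]
  have : ellZ (shiftVec (1 : Fin 3) (((64 : ℤ) * D : ℤ) : ZMod (128 * D))) k =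
      (((D : ℤ) * (64 * k 1) : ℤ) : ZMod (128 * D)) := by
    simp only [ellZ, shiftVec, if_true, show (0 : Fin 3) ≠ 1 by decide, show (2 : Fin 3) ≠ 1 by decide,
      if_false]
    push_cast; ring
  rw [this]; ring

/-- `bZK_smul_right` (auxiliary). [folklore] -/
theorem bZK_smul_right {M : ℕ} (r u : Fin 3 → ZMod M) (t : ZMod M) : bZK r (t • u) = t * bZK r u := by
  simp only [bZK, Pi.smul_apply, smul_eq_mul]; ring

/-- `nZK_smul` (auxiliary). [folklore] -/
theorem nZK_smul {M : ℕ} (t : ZMod M) (u : Fin 3 → ZMod M) : nZK (t • u) = t ^ 2 * nZK u := by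
  simp only [nZK, Pi.smul_apply, smul_eq_mul]; ring

/-- **On the support the Gauss coefficient sum is a cone Gauss sum** (`N = 128D`, `aa' = 1`):
`∑_r w_D(r) ψ_N(a Δ(r) + B(r, u)) = ψ_N(-a' Δ(u)) · w_D(-a'u) · 128N · G(a; N)`. [folklore] -/
theorem sum_wDK_mul_stdAddChar_bZK {D : ℕ} [NeZero D] (hsq : Squarefree D) (hodd : Odd D)
    (a a' : ZMod (128 * D)) (haa' : a * a' = 1) (u : Fin 3 → ZMod (128 * D)) :
    ∑ r : Fin 3 → ZMod (128 * D), wDK D r * ZMod.stdAddChar (a * nZK r + bZK r u) =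
      ZMod.stdAddChar (-(a' * nZK u)) * (wDK D (-(a' • u)) * (128 * (128 * D : ℕ)) *
        quadGaussSum (128 * D) a 0) := by
  have ha : IsUnit a := IsUnit.of_mul_eq_one a' haa'
  have key : ∀ r : Fin 3 → ZMod (128 * D),
      a * nZK r + bZK r u = a * nZK (r + a' • u) + -(a' * nZK u) := by
    intro r
    rw [nZK_add, bZK_smul_right, nZK_smul]
    linear_combination (-(bZK r u) - a' * nZK u) * haa'
  simp_rw [key, AddChar.map_add_eq_mul]
  rw [← coneSumK_wDK hsq hodd a ha (a' • u), coneSumK, Finset.mul_sum]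
  refine Fintype.sum_equiv (Equiv.addRight (a' • u)) _ _ fun r ↦ ?_
  simp only [Equiv.coe_addRight, add_sub_cancel_right]
  ring

end DPart

end Literature.NumberTheory.EllipticCurves.Shintani
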